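import Summits.HodgeConjecture.CorCM.Census.CyclicPrimeFacesDescent

/-!
# Faces generate the Hodge lattice of the cyclic slice of prime degree, II: the class functional, the closing face, and the
# theorem — `(2^{p−1} − 1)/p` rank-four face classes generate, for every odd prime `p`

COR-CM (cell `pub-hodgecm2`), count-neutral kernel census by the binder seat b09 (gen 25; lane CYCLIC-PRIME-FACES, part IV of
`CyclicPrimeTypeModel` → `CyclicPrimeTypeSquares` → `CyclicPrimeFacesDescent` → `CyclicPrimeFacesGenerate` → `CyclicPrimeFacesSlice`;
the kernel form of «Theorem C» of the seat note `HOME/pub-hodgecm2-b09/lean-g24/DEG22-MU.md` §4/§4 bis, there checked by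
certificate for `p ≤ 19` only).  Bookkeeping definitions + theorems; no `decide` table, no certificate, no named fact, no geometry,
no `sorry`.  HC_CM is not proved anywhere in this cell; nothing here is a headline and nothing here produces a period.

THE THEOREM (`hodge_le_pairs_sup_spanFaces_family`, `family_card`, `family_card_eq`).  `p` an odd prime, `K = (p − 1)/2`.  In the
representative-free model of the full slice of `(ℤ/2p, p)` (parts I–II) let `family` = the canonical squares (part III: one face
`(rep ω; i, j)` per simple factor `ω` of defect class `≥ 2`) together with ONE closing face `s⋆ = (𝟙_I; 0, K)`, `I = {1, …, K − 1}`.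
Then  **`H ≤ P ⊔ ℤ⟨Galois translates of the face classes of family⟩`**  and  **`|family| = #(simple factors ≠ E) = (2^p − 2)/(2p)
= (2^{p−1} − 1)/p`** (b17's `card_orbits_eq`).  With b17's parity law (`cyclicPrime_law`: no family of fewer than `(2^p − 2)/(2p)`
vectors of ANY kind generates) this says: the least number of Galois orbits of generators of the Hodge ring of the whole slice
modulo divisor classes is attained by RANK-FOUR FACE classes, uniformly in `p` — `1, 3, 9, 93, 315, 3855, 13797, …` faces for
`2p = 6, 10, 14, 22, 26, 34, 38, …` (dictionary reading for lane 2 of the cell: that many face-period orbits per cyclic CM field of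
prime degree `p` over its imaginary quadratic subfield, and no fewer exceptional orbits of any kind).  Part V transports the
statement to b17's sigma-type model of record.

PROOF (kernel; part III + this file).  (1) KEY LEMMA (part III, `eq_smul_weil_of_wt_le_one`): a Hodge vector supported on the
labels of weight `≤ 1` (`0` and the `δ s`) is a multiple of `weil = Σ_s e_{δ s} − (p − 2)·e_0` (the Weil class of `E^{p−2} × B₁`).
(2) THE CLASS FUNCTIONAL `Cfun m = Σ_ψ cwt(ψ)·m(ψ)`,
`cwt ψ = wt ψ` if `wt ψ ≤ p/2` and `wt ψ − p` otherwise: it kills the pairs (`cwt (ψ+1) = −cwt ψ`, `p` odd), changes at most by a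
sign under Galois translation, VANISHES on every canonical square (corner weights `K, 1 − K, 1 − K, K − 2` after signing), takes
the value `p` on `weil` and `−p` on the class of the closing face (signed corner weights `K − 1, −K, −K, −K`).  (3) By part III every
vector is `≡` (mod `P ⊔` squares) to a vector supported in weight `≤ 1`, which for a Hodge vector is `ρ·weil` by (1); for the
closing face class `Cfun` gives `−p = ρ·p`, so `ρ = −1` and `weil ∈ P ⊔ ℤ[G]·family`; then every Hodge vector lies there.
(4) COUNT: `sqFace` is injective on simple factors (the representative determines the factor), the closing face is not a square
(its first place is not a defect), and exactly one simple factor has class `1` (the factor `B₁` of the `δ s`).  All [folklore].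

## References
* [Pohlmann1968] H. Pohlmann, Algebraic cycles on abelian varieties of complex multiplication type, Ann. of Math. 88 (1968), Thm 1.
* [Milne1999] J. S. Milne, Lefschetz motives and the Tate conjecture, Compositio Math. 117 (1999), Prop. 2.1, p. 54.
* [Weil1977HodgeRing] A. Weil, Abelian varieties and the Hodge ring, Œuvres Scientifiques III, [1977c], 421–429.
-/

namespace Summit.HodgeConjecture.CorCM.Census.CyclicPrimeFacesGenerate

open Finset
open Summit.HodgeConjecture.CorCM.Census.CyclicPrimeTypeModel
open Summit.HodgeConjecture.CorCM.Census.CyclicPrimeTypeSquares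
open Summit.HodgeConjecture.CorCM.Census.CyclicPrimeFacesDescent


section Main

variable (p : ℕ) [hp : Fact p.Prime]

/-! ## §1 The class functional -/

/-- The signed weight `cwt ψ = wt ψ` for normalised labels, `wt ψ − p` otherwise. [folklore] -/
def cwt (ψ : Ty p) : ℤ := if wt p ψ ≤ p / 2 then (wt p ψ : ℤ) else (wt p ψ : ℤ) - p

/-- **The class functional** `Cfun m = Σ_ψ cwt(ψ) m(ψ)`. [folklore] -/
def Cfun : (Ty p → ℤ) →ₗ[ℤ] ℤ where
  toFun m := cwt p ⬝ᵥ m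
  map_add' m m' := dotProduct_add _ _ _
  map_smul' c m := by
    show cwt p ⬝ᵥ (c • m) = c • (cwt p ⬝ᵥ m)
    exact dotProduct_smul c (cwt p) m

/-- `Cfun` on a unit vector. [folklore] -/
theorem Cfun_single (ψ : Ty p) (c : ℤ) : Cfun p (Pi.single ψ c) = cwt p ψ * c := by
  show cwt p ⬝ᵥ Pi.single ψ c = cwt p ψ * c
  rw [dotProduct_single]

/-- Signed weight of the conjugate: `cwt (ψ + 1) = −cwt ψ` (`p` odd). [folklore] -/
theorem cwt_add_one (hp2 : p ≠ 2) (ψ : Ty p) : cwt p (ψ + 1) = -cwt p ψ := by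
  have hodd : p % 2 = 1 := hp.out.mod_two_eq_one_iff_ne_two.mpr hp2
  have hw := wt_le p ψ
  unfold cwt
  rw [wt_add_one]
  by_cases h : wt p ψ ≤ p / 2
  · rw [if_pos h, if_neg (by omega), Nat.cast_sub hw]; ring
  · rw [if_neg h, if_pos (by omega), Nat.cast_sub hw]; ring

/-- Signed weight is invariant under `(0,t)`-twists. [folklore] -/
theorem cwt_tw_zero (t : ZMod p) (ψ : Ty p) : cwt p (tw p (0, t) ψ) = cwt p ψ := by
  unfold cwt; rw [wt_tw_zero]

/-- Signed weight of a twist: `± cwt`. [folklore] -/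
theorem cwt_tw (hp2 : p ≠ 2) (g : ZMod 2 × ZMod p) (ψ : Ty p) :
    cwt p (tw p g ψ) = (if g.1 = 0 then 1 else -1) * cwt p ψ := by
  obtain ⟨a, t⟩ := g
  have h01 : ∀ u : ZMod 2, u = 0 ∨ u = 1 := by decide
  rcases h01 a with rfl | rfl
  · rw [cwt_tw_zero]; simp
  · rw [tw_one, cwt_add_one p hp2, cwt_tw_zero]; simp

/-- `Cfun` kills the pairs. [folklore] -/
theorem Cfun_pairVec (hp2 : p ≠ 2) (ψ : Ty p) : Cfun p (pairVec p ψ) = 0 := by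
  unfold pairVec
  rw [map_add, Cfun_single, Cfun_single, cwt_add_one p hp2]
  ring

/-- `Cfun` changes at most by a sign under Galois translation. [folklore] -/
theorem Cfun_transl (hp2 : p ≠ 2) (g : ZMod 2 × ZMod p) (v : Ty p → ℤ) :
    Cfun p (transl p g v) = (if g.1 = 0 then 1 else -1) * Cfun p v := by
  show cwt p ⬝ᵥ transl p g v = (if g.1 = 0 then 1 else -1) * (cwt p ⬝ᵥ v)
  rw [transl_eq_comp, dotProduct_comp_equiv_symm]
  have hc : (cwt p ∘ (twEquiv p g)) = (if g.1 = 0 then (1 : ℤ) else -1) • cwt p := by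
    funext ψ
    show cwt p (tw p g ψ) = ((if g.1 = 0 then (1 : ℤ) else -1) • cwt p) ψ
    rw [Pi.smul_apply, smul_eq_mul, cwt_tw p hp2]
  rw [hc, smul_dotProduct, smul_eq_mul]

/-- `Cfun` of a face class, corner by corner. [folklore] -/
theorem Cfun_faceVec (φ : Ty p) (i j : ZMod p) :
    Cfun p (faceVec p φ i j) = cwt p φ + cwt p (φ + 1 + δ p i) + cwt p (φ + 1 + δ p j) + cwt p (φ + δ p i + δ p j) := by
  unfold faceVec
  rw [map_add, map_add, map_add, Cfun_single, Cfun_single, Cfun_single, Cfun_single]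
  ring

/-- **`Cfun` vanishes on the class of every face through two defects of a normalised type of weight `≥ 2`** (signed corner
weights `K, 1 − K, 1 − K, K − 2`). [folklore] -/
theorem Cfun_faceVec_eq_zero (hp2 : p ≠ 2) {φ : Ty p} {i j : ZMod p} (hi : φ i = 1) (hj : φ j = 1) (hij : i ≠ j)
    (hφ : wt p φ ≤ p / 2) : Cfun p (faceVec p φ i j) = 0 := by
  have hodd : p % 2 = 1 := hp.out.mod_two_eq_one_iff_ne_two.mpr hp2
  have hw := wt_le p φ
  have h2φ : 2 ≤ wt p φ := by
    unfold wt
    exact Finset.one_lt_card_iff.mpr ⟨i, j, by simp [hi], by simp [hj], hij⟩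
  rw [Cfun_faceVec]
  unfold cwt
  have c1 : ¬ (p - wt p φ + 1 ≤ p / 2) := by omega
  have c2 : wt p φ - 2 ≤ p / 2 := by omega
  rw [wt_corner_bar p hi, wt_corner_bar p hj, wt_corner_flip p hi hj hij, if_pos hφ, if_neg c1, if_pos c2]
  have e1 : ((p - wt p φ + 1 : ℕ) : ℤ) = (p : ℤ) - (wt p φ : ℤ) + 1 := by
    rw [Nat.cast_add, Nat.cast_sub hw]; simp
  have e2 : ((wt p φ - 2 : ℕ) : ℤ) = (wt p φ : ℤ) - 2 := by rw [Nat.cast_sub h2φ]; simp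
  rw [e1, e2]
  ring

/-- `Cfun` vanishes on `P ⊔ spanFaces squares`. [folklore] -/
theorem Cfun_eq_zero_of_mem (hp2 : p ≠ 2) {v : Ty p → ℤ} (hv : v ∈ pairs p ⊔ spanFaces p (squares p)) : Cfun p v = 0 := by
  have hle : pairs p ⊔ spanFaces p (squares p) ≤ LinearMap.ker (Cfun p) := by
    refine sup_le (Submodule.span_le.mpr ?_) (Submodule.span_le.mpr ?_)
    · rintro _ ⟨ψ, rfl⟩
      exact Cfun_pairVec p hp2 ψ
    · rintro _ ⟨g, f, hf, rfl⟩
      obtain ⟨ω, hω, rfl⟩ := Finset.mem_image.mp hf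
      have h2 : 2 ≤ wt p (rep p ω) := by rw [wt_rep]; exact (Finset.mem_filter.mp hω).2
      obtain ⟨hij, hi, hj⟩ := pick_spec p h2
      show Cfun p (transl p g (faceVec p (rep p ω) (pick p (rep p ω)).1 (pick p (rep p ω)).2)) = 0
      rw [Cfun_transl p hp2, Cfun_faceVec_eq_zero p hp2 hi hj hij (by rw [wt_rep]; exact (one_le_cls p ω).2), mul_zero]
  exact hle hv

/-- **`Cfun weil = p`.** [folklore] -/
theorem Cfun_weil : Cfun p (weil p) = p := by
  have h1 : 1 ≤ p / 2 := by
    have := hp.out.two_le; omega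
  unfold weil
  rw [map_sub, map_sum, map_smul, Cfun_single, smul_eq_mul]
  simp_rw [Cfun_single]
  unfold cwt
  simp_rw [wt_delta, wt_zero]
  rw [if_pos h1, if_pos (Nat.zero_le _)]
  simp [Finset.sum_const, Finset.card_univ, ZMod.card]

/-! ## §2 The closing face -/

/-- The defect set `I = {1, …, K − 1}` of the closing face, `K = p/2`. [folklore] -/
def Iset : Finset (ZMod p) := (Finset.range (p / 2 - 1)).image fun n : ℕ => ((n + 1 : ℕ) : ZMod p)

/-- **The closing face** `s⋆ = (𝟙_I; 0, K)`: its corners `𝟙_I, 𝟙_{Iᶜ∖0}, 𝟙_{Iᶜ∖K}, 𝟙_{I ∪ {0,K}}` have weights `K − 1, K + 1, K + 1,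
K + 1` — the face `(T_{[1,K−1]}; π₀, π_K)` of the seat note, in the three interval classes `K` and the interval class `K − 1`.
[folklore] -/
noncomputable def sStar : Ty p × ZMod p × ZMod p := (ind p (Iset p), 0, ((p / 2 : ℕ) : ZMod p))

/-- The canonical squares and the closing face. [folklore] -/
noncomputable def family : Finset (Ty p × ZMod p × ZMod p) := squares p ∪ {sStar p}

/-- `|I| = K − 1`. [folklore] -/
theorem card_Iset : (Iset p).card = p / 2 - 1 := by
  unfold Iset
  rw [Finset.card_image_of_injOn, Finset.card_range]
  intro a ha b hb hab
  simp only [Finset.coe_range, Set.mem_Iio] at ha hb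
  have h := (ZMod.natCast_eq_natCast_iff' (a + 1) (b + 1) p).mp hab
  rw [Nat.mod_eq_of_lt (by omega), Nat.mod_eq_of_lt (by omega)] at h
  omega

/-- `0 ∉ I`. [folklore] -/
theorem zero_not_mem_Iset : (0 : ZMod p) ∉ Iset p := by
  unfold Iset
  intro h
  obtain ⟨n, hn, hn0⟩ := Finset.mem_image.mp h
  simp only [Finset.mem_range] at hn
  have h' := (ZMod.natCast_eq_zero_iff (n + 1) p).mp hn0
  have := Nat.le_of_dvd (Nat.succ_pos n) h'
  omega

/-- `K ∉ I`. [folklore] -/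
theorem half_not_mem_Iset : ((p / 2 : ℕ) : ZMod p) ∉ Iset p := by
  unfold Iset
  intro h
  obtain ⟨n, hn, hnK⟩ := Finset.mem_image.mp h
  simp only [Finset.mem_range] at hn
  have h' := (ZMod.natCast_eq_natCast_iff' (n + 1) (p / 2) p).mp hnK
  rw [Nat.mod_eq_of_lt (by omega), Nat.mod_eq_of_lt (by omega)] at h'
  omega

/-- The two places of the closing face are distinct (`p` odd). [folklore] -/
theorem sStar_places (hp2 : p ≠ 2) : (sStar p).2.1 ≠ (sStar p).2.2 := by
  have hodd : p % 2 = 1 := hp.out.mod_two_eq_one_iff_ne_two.mpr hp2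
  show (0 : ZMod p) ≠ ((p / 2 : ℕ) : ZMod p)
  intro h
  have h' := (ZMod.natCast_eq_zero_iff (p / 2) p).mp h.symm
  have h1 : 0 < p / 2 := by have := hp.out.two_le; omega
  have := Nat.le_of_dvd h1 h'
  omega

/-- **`Cfun` of the closing face class is `−p`** (signed corner weights `K − 1, −K, −K, −K`). [folklore] -/
theorem Cfun_sStar (hp2 : p ≠ 2) : Cfun p (faceVec p (sStar p).1 (sStar p).2.1 (sStar p).2.2) = -p := by
  have hodd : p % 2 = 1 := hp.out.mod_two_eq_one_iff_ne_two.mpr hp2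
  have h1 : 1 ≤ p / 2 := by have := hp.out.two_le; omega
  have hI := card_Iset p
  have h0 := zero_not_mem_Iset p
  have hKI := half_not_mem_Iset p
  have h0K : (0 : ZMod p) ∉ insert ((p / 2 : ℕ) : ZMod p) (Iset p) := by
    rw [Finset.mem_insert]; exact fun h => h.elim (sStar_places p hp2) h0
  show Cfun p (faceVec p (ind p (Iset p)) 0 ((p / 2 : ℕ) : ZMod p)) = -p
  rw [Cfun_faceVec]
  -- the four corners as indicator types
  have c2 : ind p (Iset p) + 1 + δ p 0 = ind p (insert 0 (Iset p)) + 1 := by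
    rw [add_right_comm, ind_add_delta_of_not_mem p h0]
  have c3 : ind p (Iset p) + 1 + δ p ((p / 2 : ℕ) : ZMod p) = ind p (insert ((p / 2 : ℕ) : ZMod p) (Iset p)) + 1 := by
    rw [add_right_comm, ind_add_delta_of_not_mem p hKI]
  have c4 : ind p (Iset p) + δ p 0 + δ p ((p / 2 : ℕ) : ZMod p) =
      ind p (insert 0 (insert ((p / 2 : ℕ) : ZMod p) (Iset p))) := by
    rw [add_right_comm, ind_add_delta_of_not_mem p hKI, ind_add_delta_of_not_mem p h0K]
  rw [c2, c3, c4]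
  unfold cwt
  rw [wt_add_one, wt_add_one, wt_ind, wt_ind, wt_ind, wt_ind, Finset.card_insert_of_notMem h0,
    Finset.card_insert_of_notMem hKI, Finset.card_insert_of_notMem h0K, Finset.card_insert_of_notMem hKI, hI]
  have d1 : p / 2 - 1 ≤ p / 2 := by omega
  have d2 : ¬ (p - (p / 2 - 1 + 1) ≤ p / 2) := by omega
  have d3 : ¬ (p / 2 - 1 + 1 + 1 ≤ p / 2) := by omega
  rw [if_pos d1, if_neg d2, if_neg d3]
  have e1 : ((p / 2 - 1 : ℕ) : ℤ) = ((p / 2 : ℕ) : ℤ) - 1 := by rw [Nat.cast_sub h1]; simp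
  have e2 : ((p - (p / 2 - 1 + 1) : ℕ) : ℤ) = (p : ℤ) - ((p / 2 : ℕ) : ℤ) := by
    rw [Nat.sub_add_cancel h1, Nat.cast_sub (Nat.div_le_self p 2)]
  have e3 : ((p / 2 - 1 + 1 + 1 : ℕ) : ℤ) = ((p / 2 : ℕ) : ℤ) + 1 := by rw [Nat.sub_add_cancel h1]; push_cast; ring
  rw [e1, e2, e3]
  have hp' : (p : ℤ) = 2 * ((p / 2 : ℕ) : ℤ) + 1 := by
    have h2 : p = 2 * (p / 2) + 1 := by omega
    exact_mod_cast h2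
  rw [hp']
  ring

/-! ## §3 The theorem and the count -/

/-- All faces of the family have distinct places. [folklore] -/
theorem family_places (hp2 : p ≠ 2) {f : Ty p × ZMod p × ZMod p} (hf : f ∈ family p) : f.2.1 ≠ f.2.2 := by
  rcases Finset.mem_union.mp hf with h | h
  · exact squares_places p h
  · rw [Finset.mem_singleton] at h; rw [h]; exact sStar_places p hp2

/-- **The Weil vector lies in `P ⊔ ℤ[G]·family`.** [folklore] -/
theorem weil_mem (hp2 : p ≠ 2) : weil p ∈ pairs p ⊔ spanFaces p (family p) := by
  set mstar := faceVec p (sStar p).1 (sStar p).2.1 (sStar p).2.2 with hm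
  have hmH : mstar ∈ hodge p := faceVec_mem p _ (sStar_places p hp2)
  obtain ⟨r, hr, hdiff⟩ := exists_reduced p hp2 mstar
  have hsub : pairs p ⊔ spanFaces p (squares p) ≤ hodge p :=
    sup_le (pairs_le_hodge p) (spanFaces_le_hodge p fun f hf => squares_places p hf)
  have hrH : r ∈ hodge p := by
    have : r = mstar - (mstar - r) := by abel
    rw [this]; exact Submodule.sub_mem _ hmH (hsub hdiff)
  have hreq := eq_smul_weil_of_wt_le_one p r hrH hr
  -- apply the class functional
  have hC : Cfun p mstar - Cfun p r = 0 := by rw [← map_sub]; exact Cfun_eq_zero_of_mem p hp2 hdiff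
  rw [hm, Cfun_sStar p hp2, hreq, map_smul, Cfun_weil, smul_eq_mul] at hC
  have hρ : r (δ p 0) = -1 := by
    have hp0 : (p : ℤ) ≠ 0 := by exact_mod_cast hp.out.ne_zero
    have : (r (δ p 0) + 1) * (p : ℤ) = 0 := by linarith
    rcases mul_eq_zero.mp this with h | h
    · linarith
    · exact absurd h hp0
  rw [hρ, neg_one_smul] at hreq
  -- `weil = (mstar − r) − mstar`
  have hw : weil p = (mstar - r) - mstar := by rw [hreq]; abel
  rw [hw]
  refine Submodule.sub_mem _ ?_ ?_
  · exact (sup_le_sup_left (spanFaces_mono p Finset.subset_union_left) _) hdiff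
  · refine Submodule.mem_sup_right (Submodule.subset_span ⟨0, sStar p, ?_, ?_⟩)
    · exact Finset.mem_union_right _ (Finset.mem_singleton_self _)
    · rw [hm, transl_zero]

/-- **THE THEOREM.**  For every odd prime `p`, the Hodge lattice of the full slice of `(ℤ/2p, p)` is generated, together with the
divisor classes, by the Galois translates of the classes of the rank-four faces of `family` (the canonical squares and the
closing face). [folklore] -/
theorem hodge_le_pairs_sup_spanFaces_family (hp2 : p ≠ 2) : hodge p ≤ pairs p ⊔ spanFaces p (family p) := by
  intro m hm
  obtain ⟨r, hr, hdiff⟩ := exists_reduced p hp2 m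
  have hsub : pairs p ⊔ spanFaces p (squares p) ≤ hodge p :=
    sup_le (pairs_le_hodge p) (spanFaces_le_hodge p fun f hf => squares_places p hf)
  have hrH : r ∈ hodge p := by
    have : r = m - (m - r) := by abel
    rw [this]; exact Submodule.sub_mem _ hm (hsub hdiff)
  have hreq := eq_smul_weil_of_wt_le_one p r hrH hr
  have : m = (m - r) + r := by abel
  rw [this]
  refine Submodule.add_mem _ ((sup_le_sup_left (spanFaces_mono p Finset.subset_union_left) _) hdiff) ?_
  rw [hreq]
  exact Submodule.smul_mem _ _ (weil_mem p hp2)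

/-- The representative of a simple factor is nonconstant. [folklore] -/
theorem rep_nonconst (ω : OddDegreeParityLaw.Orbits p) : ¬ ∀ y, rep p ω y = rep p ω 0 := by
  have h := one_le_cls p ω
  have hodd : p / 2 < p := Nat.div_lt_self hp.out.pos one_lt_two
  exact nonconst_of_wt p (by rw [wt_rep]; omega) (by rw [wt_rep]; omega)

/-- The simple factor of the representative is the factor itself. [folklore] -/
theorem mk_rep (ω : OddDegreeParityLaw.Orbits p) :
    (Quotient.mk _ (⟨rep p ω, rep_nonconst p ω⟩ : OddDegreeParityLaw.Nonconst (ZMod p)) : OddDegreeParityLaw.Orbits p) = ω := by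
  obtain ⟨g, hg⟩ := exists_tw_out_eq_rep p ω
  conv_rhs => rw [← Quotient.out_eq ω]
  refine Quotient.sound (AddAction.orbitRel_apply.mpr (AddAction.mem_orbit_iff.mpr ⟨(g.1, -g.2), ?_⟩))
  apply Subtype.ext
  rw [vadd_val_eq_tw]
  show tw p (g.1, - -g.2) (Quotient.out ω).1 = rep p ω
  rw [neg_neg, ← hg]

/-- `sqFace` is injective on simple factors. [folklore] -/
theorem sqFace_injective : Function.Injective (sqFace p) := by
  intro ω ω' h
  have h1 : rep p ω = rep p ω' := congrArg Prod.fst h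
  rw [← mk_rep p ω, ← mk_rep p ω']
  exact congrArg _ (Subtype.ext h1)

/-- The closing face is not a canonical square (its first place is not a defect of its type). [folklore] -/
theorem sStar_not_mem_squares : sStar p ∉ squares p := by
  intro h
  obtain ⟨ω, hω, hωeq⟩ := Finset.mem_image.mp h
  have h2 : 2 ≤ wt p (rep p ω) := by rw [wt_rep]; exact (Finset.mem_filter.mp hω).2
  have hdef := (pick_spec p h2).2.1
  have e1 : rep p ω = ind p (Iset p) := congrArg Prod.fst hωeq
  have e2 : (pick p (rep p ω)).1 = 0 := congrArg (fun f => f.2.1) hωeq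
  rw [e2, e1] at hdef
  simp only [ind, if_neg (zero_not_mem_Iset p)] at hdef
  exact absurd hdef (by decide)

/-- The single-defect simple factor `B₁`: the orbit of `δ 0`. [folklore] -/
noncomputable def B1 : OddDegreeParityLaw.Orbits p :=
  Quotient.mk _ ⟨δ p 0, nonconst_of_wt p (by rw [wt_delta]; exact Nat.one_pos) (by rw [wt_delta]; exact hp.out.one_lt)⟩

/-- **Exactly one simple factor has defect class `< 2`**, namely `B₁`. [folklore] -/
theorem cls_lt_two_iff (ω : OddDegreeParityLaw.Orbits p) : cls p ω < 2 ↔ ω = B1 p := by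
  constructor
  · intro h
    have h1 : wt p (rep p ω) = 1 := by rw [wt_rep]; have := one_le_cls p ω; omega
    rcases eq_zero_or_eq_delta_of_wt_le_one p (le_of_eq h1) with h0 | ⟨s, hs⟩
    · rw [h0, wt_zero] at h1; exact absurd h1 (by decide)
    · rw [← mk_rep p ω]
      unfold B1
      refine Quotient.sound (AddAction.orbitRel_apply.mpr (AddAction.mem_orbit_iff.mpr ⟨(0, s), ?_⟩))
      apply Subtype.ext
      rw [vadd_val_eq_tw]
      show tw p (0, -s) (δ p 0) = rep p ω
      rw [hs]
      funext x
      simp only [tw, delta_apply, add_zero, add_neg_eq_zero]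
  · rintro rfl
    unfold B1
    rw [cls_mk]
    show min (wt p (δ p 0)) (p - wt p (δ p 0)) < 2
    rw [wt_delta]
    omega

/-- **`|family| = #(simple factors ≠ E)`.** [folklore] -/
theorem family_card : (family p).card = Fintype.card (OddDegreeParityLaw.Orbits p) := by
  unfold family
  rw [Finset.card_union_of_disjoint (Finset.disjoint_singleton_right.mpr (sStar_not_mem_squares p)),
    Finset.card_singleton]
  unfold squares
  rw [Finset.card_image_of_injective _ (sqFace_injective p)]
  have hneg : (univ.filter fun ω : OddDegreeParityLaw.Orbits p => ¬ 2 ≤ cls p ω).card = 1 := by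
    rw [Finset.card_eq_one]
    refine ⟨B1 p, ?_⟩
    ext ω
    simp only [Finset.mem_filter, Finset.mem_univ, true_and, Finset.mem_singleton, not_le]
    exact cls_lt_two_iff p ω
  have h := Finset.card_filter_add_card_filter_not (s := (univ : Finset (OddDegreeParityLaw.Orbits p)))
    (fun ω => 2 ≤ cls p ω)
  rw [hneg, Finset.card_univ] at h
  exact h

/-- **`|family| = (2^p − 2)/(2p) = (2^{p−1} − 1)/p`** (b17's orbit count). [folklore] -/
theorem family_card_eq (hp2 : p ≠ 2) : (family p).card = (2 ^ p - 2) / (2 * p) := by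
  rw [family_card p, ← Nat.card_eq_fintype_card]
  exact OddDegreeParityLaw.card_orbits_eq p hp2

end Main

end Summit.HodgeConjecture.CorCM.Census.CyclicPrimeFacesGenerate
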